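import Literature.MathematicalPhysics.QuantumFieldTheory.Balaban1983to89.Node00.Record8Inhabited
import Summits.QuantumFields.YangMills.Theorems.BalabanUVNodesN28AtRecord8

/-!
# BalabanUVNodes ∕ N28 — binder B6 «`0 < β̄`, `0 < γc`» AT THE ZERO CHART of NODE 00's Stage-8 record predicate:
# which of N28's two side conditions the cheap inhabitant of `IsRecordOfRecord₈C` satisfies (kernel form of the
# chair's ZEROCHART rider v0.33, R445 (A), for node N28; Track A, DAG node N28 of 28; count-neutral)

HONEST FRAMING.  Count-neutral kernel bookkeeping; NOT a node discharge, not an estimate, nothing of Bałaban's β asserted or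
refuted.  N28 is VACATED in the discharge form of record and «closes with B3» (N25 = NODE O).  dag-n23-b's
`Node00/Record8Inhabited.lean` (p416375) certifies that `Node00.Stage8Params.Admissible` puts no clause on the β-layer's chart
`(Vβ, ρ8, bV, v₀)` and that at the ZERO chart `ρ8 = 0` the Stage-8 β-functions of record VANISH IDENTICALLY
(`βfun_datumOfRecord₈_of_zeroChart`), whence director-ym LINE №31 ∕ chair R445 (A): no N26 ∕ (D4)-instance ∕ N28 claim typed in `∃`-form
over the record predicate is recorded as a discharge, and «N28 (B6) keeps control rule v0.29 (constants read from the SAME witness)».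
This module is that rider READ THROUGH N28's TWO SIDE CONDITIONS, in the kernel:

* §1 AT THE ZERO β-FUNCTION FAMILY `zeroHBeta` (pure `FlowStep` facts).  (B4) `BetaContH γc` holds on EVERY box; a lower box
  bound `BetaLowerH b γ` holds iff `b ≤ 0` and an upper one iff `0 ≤ β'` (`γ > 0`); the sign typing `BetaSignH` holds, asymptotic
  freedom `BetaAFH` FAILS; the literal (B3) `BetaPertH zeroHBeta β̄` holds IFF `β̄ = 0` (`betaPertH_zeroHBeta_iff`: `|β̄| ≤ Cγ²` for
  all small `γ` forces `β̄ = 0`, a `𝓝[>] 0` limit); so the packaged literal β-binder `T4Continuum.BetaPertHyp` (= (B3) ∧ `0 < β̄` ∧ (B4) ∧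
  `0 < γc`) FAILS at `zeroHBeta` (`not_betaPertHyp_zeroHBeta`) while the same package WITHOUT N28's clause `0 < β̄` HOLDS
  (`betaPertHyp_dropSign_zeroHBeta`); and every one-loop split of `zeroHBeta` has `β⁰_k = 0`, `β¹ ≡ 0`.
* §2 AT A ZERO-CHART STAGE-8 PARAMETER `θ` (`θ.ρ8 = 0`; datum `D := datumOfRecord₅ F N (θ.toStage5 F N)`).  N28's `γc`-HALF is
  JUNK-TRUE: (B4) holds for `D.βfun` on every box, so `∃ γc, 0 < γc ∧ BetaContH γc D.βfun` (`b4_with_sideCondition_record₈_of_zeroChart`),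
  and even the merged-β slot of the ₈ knits is junk-true (`betaContH_merged₈_of_zeroChart`).  N28's `β̄`-HALF is JUNK-FALSE in
  EVERY currency the tree uses: the one-loop numbers OF RECORD vanish — `Sβ.β0 k = 0` for every split of `D.βfun`
  (`oneLoopSplit_β0_record₈_of_zeroChart`), `beta0OfMerged βm₈ θ.v₀ = 0` by name (`beta0OfMerged_record₈_of_zeroChart`) — so (AF-0)
  `0 < β⁰_k` fails; `BetaAFH D.βfun` fails; a uniform AF bound `BetaLowerH b γ' D.βfun` with `b > 0` (the DISPLAYED hypothesis `hlo` of
  `N28AtRecord8.beta0_record₈_pos_of_betaLowerH`, control rule v0.29's shape) is FALSE there (`not_betaLowerH_record₈_of_zeroChart`) — that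
  lemma is not dischargeable by the cheap inhabitant; and the literal package `BetaPertHyp D.βfun` FAILS
  (`not_betaPertHyp_record₈_of_zeroChart`) while the package without `0 < β̄` HOLDS (`betaPertHyp_dropSign_record₈_of_zeroChart`).
  Contrapositively, N28's `β̄ > 0` read at the SAME witness CERTIFIES a non-zero chart `θ.ρ8 ≠ 0` in each currency
  (`rho8_ne_zero_of_beta0_pos`, `rho8_ne_zero_of_betaLowerH`, `rho8_ne_zero_of_betaPertHyp`) — B6 is itself a weak chart clause.
* §3 OVER THE PREDICATE (`exists_isRecordOfRecord₈C_b6Census`): a Stage-8 record `(D, w)` EXISTS at which N28's `γc`-half (with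
  (B4)) holds, the literal package minus `0 < β̄` holds, every one-loop number of record is `0`, and `BetaAFH` ∕ `BetaPertHyp` fail.
  READING: of the four conjuncts of the literal β-binder, N28's `0 < β̄` is EXACTLY the one the cheap inhabitant violates — so an
  `∃`-face over `IsRecordOfRecord₈C` reading N28's `γc`-half (or (B4), or the window) is junk-satisfiable, an `∃`-face reading N28's
  `β̄`-half in any currency is NOT satisfied by the zero chart, and (v0.29) `β̄ > 0` must be read from a witness DISPLAYING an AF
  bound ∕ a non-degenerate chart — never from the record predicate alone.  (That `DagBinding.EndpointExistence`, the form of record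
  that VACATES N28, is junk-TRUE at the same inhabitant is n23-b's `endpointExistence_datumOfRecord₈_of_zeroChart`, not restated.)
* §4 THE WINDOW FORM OF THE (B4)-WITH-`0 < γc` SLOT (referee dag-ref-D note N-n28-6 on p415140): the merged-β continuity input is
  asked on the binding world's OWN box `]0, w.γ]^{k+1}` only (`b4_with_sideCondition_record₈_window`,
  `exists_b4_of_isRecordOfRecord₈C_window`), not on every realiser's record box; realiser-independent by box agreement
  (`betaContH_merged₈_of_b4_window`; the one-box `iff` is dag-n26-a's `BalabanUVNodesN26AtRecord8.betaContH_datumOfRecord₈_iff`, cited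
  not restated).
Elementary throughout; `θ` a PARAMETER; 0 `def`, 0 `sorry`, standard axioms.  Sources: T. Bałaban, CMP **109** (1987) 249–301
[Balaban1987RG1] (1.20)–(1.22) p. 264, (2.12)–(2.14) p. 268, Thm 2 (0.31) p. 259; CMP **122** (1989) 355–392 [Balaban1989LargeFieldII]
Thm 1 p. 355.  One finite four-torus programme at fixed `ε`; nothing continuum ∕ ℝ⁴ ∕ OS ∕ mass-gap ∕ Clay.
-/

namespace Summit.QuantumFields.YangMills.BalabanUVNodes.N28ZeroChart

open Literature.MathematicalPhysics.QuantumFieldTheory.Balaban1983to89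
open Literature.MathematicalPhysics.QuantumFieldTheory.Balaban1983to89.FlowStep
open Literature.MathematicalPhysics.QuantumFieldTheory.Balaban1983to89.Node00
open Literature.MathematicalPhysics.QuantumFieldTheory.Balaban1983to89.Node00.Record8Inhabited
  (βfun_datumOfRecord₈_of_zeroChart exists_admissible_stage8Params_zeroChart exists_world_isRecordOfRecord₈C
    betaMerged_zeroChart beta0OfMerged_zeroHBeta)
open Literature.MathematicalPhysics.QuantumFieldTheory.Balaban1983to89.T4Continuum (T4Family BetaPertHyp FiniteEpsData)
open Literature.MathematicalPhysics.QuantumFieldTheory.Balaban1983to89.T4FiniteEpsInhabited (zeroHBeta)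
open Literature.MathematicalPhysics.QuantumFieldTheory.Balaban1983to89.DagBinding (WorldP)
open Literature.MathematicalPhysics.QuantumFieldTheory.Balaban1983to89.BetaPertRigid (const_mem_box)
open Summit.QuantumFields.YangMills.BalabanUVNodes.N28AtBetaOfRecord (betaContH_betaOfMerged_of_le
  betaContH_merged_of_betaOfMerged)
open Filter Topology
open scoped Matrix.Norms.L2Operator

/-! ## §1 The β-side binders at the ZERO β-function family -/

/-- Unfolding: the zero β-function family is `0` at every scale and history. [folklore] -/
theorem zeroHBeta_apply (k : ℕ) (v : Fin (k + 1) → ℝ) : zeroHBeta k v = 0 := rfl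

/-- (B4) at the zero family: `BetaContH γ zeroHBeta` on EVERY box (constants are continuous). [cite: Balaban1987RG1, §1 p.264] -/
theorem betaContH_zeroHBeta (γ : ℝ) : BetaContH γ zeroHBeta := fun _ => continuousOn_const

/-- A uniform lower box bound `b ≤ β` holds at the zero family iff `b ≤ 0` (the box `]0,γ]^{k+1}` is non-empty for `γ > 0`):
`BetaLowerH b γ zeroHBeta ↔ b ≤ 0`. [cite: Balaban1987RG1, Thm 2 (0.31) p.259] -/
theorem betaLowerH_zeroHBeta_iff {b γ : ℝ} (hγ : 0 < γ) : BetaLowerH b γ zeroHBeta ↔ b ≤ 0 :=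
  ⟨fun h => h 0 _ (const_mem_box hγ 0), fun hb _ _ _ => hb⟩

/-- A uniform upper box bound `β ≤ β'` holds at the zero family iff `0 ≤ β'` (`γ > 0`): `BetaUpperH β' γ zeroHBeta ↔ 0 ≤ β'`.
[cite: Balaban1987RG1, §1 p.264] -/
theorem betaUpperH_zeroHBeta_iff {β' γ : ℝ} (hγ : 0 < γ) : BetaUpperH β' γ zeroHBeta ↔ 0 ≤ β' :=
  ⟨fun h => h 0 _ (const_mem_box hγ 0), fun hb _ _ _ => hb⟩

/-- The SIGN typing `BetaSignH` (T09.F, weak form) holds at the zero family (`0 ≤ 0`). [cite: Balaban1987RG1, §1 p.264] -/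
theorem betaSignH_zeroHBeta : BetaSignH zeroHBeta := ⟨1, one_pos, fun _ _ _ => le_rfl⟩

/-- ASYMPTOTIC FREEDOM `BetaAFH` (T09.F, strong form: `0 < b ≤ β` on a box) FAILS at the zero family. [cite: Balaban1987RG1, Thm 2 (0.31) p.259] -/
theorem not_betaAFH_zeroHBeta : ¬ BetaAFH zeroHBeta := by
  rintro ⟨γ₀, hγ₀, b, hb, hlo⟩
  exact absurd ((betaLowerH_zeroHBeta_iff hγ₀).mp hlo) (not_le.mpr hb)

/-- **The literal (B3) at the zero family holds IFF `β̄ = 0`**: `|0 − β̄| ≤ C γ²` for all `γ ∈ ]0, γ₀]` forces `β̄ = 0`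
(let `γ → 0⁺`); conversely `β̄ = 0` works with `C = 0`. [cite: Balaban1989LargeFieldII, Thm 1 p.355] -/
theorem betaPertH_zeroHBeta_iff {βbar : ℝ} : BetaPertH zeroHBeta βbar ↔ βbar = 0 := by
  constructor
  · rintro ⟨γ₀, hγ₀, C, -, h⟩
    have hev : ∀ᶠ γ in 𝓝[>] (0 : ℝ), |βbar| ≤ C * γ ^ 2 := by
      filter_upwards [Ioc_mem_nhdsGT hγ₀] with γ hγ
      have h' := h γ hγ.1 hγ.2 0 _ (const_mem_box hγ.1 0)
      rwa [zeroHBeta_apply, zero_sub, abs_neg] at h'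
    have ht : Tendsto (fun γ : ℝ => C * γ ^ 2) (𝓝[>] (0 : ℝ)) (𝓝 0) := by
      have hc : Continuous fun γ : ℝ => C * γ ^ 2 := by fun_prop
      simpa using (hc.tendsto 0).mono_left nhdsWithin_le_nhds
    exact abs_nonpos_iff.mp (ge_of_tendsto ht hev)
  · rintro rfl
    exact ⟨1, one_pos, 0, le_rfl, fun γ _ _ k v _ => by rw [zeroHBeta_apply, sub_zero, abs_zero, zero_mul]⟩

/-- **N28's `0 < β̄` IS THE FAILING CLAUSE**: the packaged literal β-binder `BetaPertHyp` (= (B3) ∧ `0 < β̄` ∧ (B4) ∧ `0 < γc`)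
FAILS at the zero family — because (B3) there forces `β̄ = 0`. [cite: Balaban1989LargeFieldII, Thm 1 p.355] -/
theorem not_betaPertHyp_zeroHBeta : ¬ BetaPertHyp zeroHBeta := by
  rintro ⟨⟨βbar, hβbar, hP⟩, -⟩
  exact hβbar.ne' (betaPertH_zeroHBeta_iff.mp hP)

/-- … whereas the SAME package WITHOUT N28's `0 < β̄` — (B3) for some `β̄`, and (B4) with `0 < γc` — HOLDS at the zero family
(`β̄ := 0`, `γc := 1`). [cite: Balaban1989LargeFieldII, Thm 1 p.355] -/
theorem betaPertHyp_dropSign_zeroHBeta :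
    (∃ βbar : ℝ, BetaPertH zeroHBeta βbar) ∧ ∃ γc : ℝ, 0 < γc ∧ BetaContH γc zeroHBeta :=
  ⟨⟨0, betaPertH_zeroHBeta_iff.mpr rfl⟩, 1, one_pos, betaContH_zeroHBeta 1⟩

/-- Every one-loop split of the zero family has vanishing one-loop numbers `β⁰_k = 0` (read `split` at the zero history and
`vanish`). [cite: Balaban1987RG1, (2.12)–(2.14) p.268] -/
theorem oneLoopSplit_β0_zeroHBeta (S : B12Beta.OneLoopSplit zeroHBeta) (k : ℕ) : S.β0 k = 0 := by
  have h := S.split k (fun _ => 0)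
  rw [S.vanish k _ rfl, add_zero, zeroHBeta_apply] at h
  exact h.symm

/-- … and vanishing remainder `β¹ ≡ 0`. [cite: Balaban1987RG1, (2.12)–(2.14) p.268] -/
theorem oneLoopSplit_β1_zeroHBeta (S : B12Beta.OneLoopSplit zeroHBeta) (k : ℕ) (v : Fin (k + 1) → ℝ) : S.β1 k v = 0 := by
  have h := S.split k v
  rw [oneLoopSplit_β0_zeroHBeta S k, zero_add, zeroHBeta_apply] at h
  exact h.symm

/-! ## §2 N28's two halves at a ZERO-CHART Stage-8 parameter -/

variable {F : T4Family} {N : ℕ} [NeZero N]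

/-- **N28's `γc`-HALF IS JUNK-TRUE AT THE ZERO CHART, on every box**: for Stage-8 parameters with `θ.ρ8 = 0`, binder (B4)
`BetaContH γc` holds for the datum's β-functions for EVERY `γc` (they are the zero family, n23-b's `βfun_datumOfRecord₈_of_zeroChart`).
[cite: Balaban1987RG1, (1.20)–(1.22) p.264] -/
theorem b4_allWindows_record₈_of_zeroChart (θ : Stage8Params F N)
    (hρ : letI := θ.instVβ₁; letI := θ.instVβ₂; θ.ρ8 = 0) (γc : ℝ) :
    BetaContH γc (datumOfRecord₅ F N (θ.toStage5 F N)).βfun := by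
  rw [βfun_datumOfRecord₈_of_zeroChart F N θ hρ]
  exact betaContH_zeroHBeta γc

/-- … hence (B4) WITH N28's side condition `0 < γc`, `∃ γc, 0 < γc ∧ BetaContH γc D.βfun`, holds at every zero-chart Stage-8 datum
(`γc := 1`): this `∃`-face is junk-satisfiable (ZEROCHART v0.33 (i)). [cite: Balaban1987RG1, (1.20)–(1.22) p.264] -/
theorem b4_with_sideCondition_record₈_of_zeroChart (θ : Stage8Params F N)
    (hρ : letI := θ.instVβ₁; letI := θ.instVβ₂; θ.ρ8 = 0) :
    ∃ γc : ℝ, 0 < γc ∧ BetaContH γc (datumOfRecord₅ F N (θ.toStage5 F N)).βfun :=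
  ⟨1, one_pos, b4_allWindows_record₈_of_zeroChart θ hρ 1⟩

/-- Even the MERGED-β slot of the Stage-8 knits (`BetaContH γ βm₈(θ)`, the input `hC` of `N28AtRecord8.b4_with_sideCondition_record₈` and of
dag-n26-a's sockets) is junk-true at the zero chart, on every box: `βm₈ = zeroHBeta` there (n23-b's `betaMerged_zeroChart`).
[cite: Balaban1987RG1, (1.20)–(1.22) p.264] -/
theorem betaContH_merged₈_of_zeroChart (θ : Stage8Params F N)
    (hρ : letI := θ.instVβ₁; letI := θ.instVβ₂; θ.ρ8 = 0) (γ : ℝ) :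
    letI := θ.instVβ₁; letI := θ.instVβ₂; letI := θ.instιβ
    BetaContH γ (betaMerged F (mergedTermFamilyMat F N (chi7 F N θ) θ.εbg) θ.ρ8 θ.bV) := by
  letI := θ.instVβ₁; letI := θ.instVβ₂; letI := θ.instιβ
  rw [hρ, betaMerged_zeroChart]
  exact betaContH_zeroHBeta γ

/-- **N28's `β̄`-HALF IS JUNK-FALSE AT THE ZERO CHART — (AF-0) currency**: every one-loop split of a zero-chart Stage-8 datum's
β-functions (in particular the split of record `Node00.oneLoopSplit_stage8 θ` that every NODE-O road reads, `N28AtRecord8.oneLoopSplit_record₈_eq`)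
has `β⁰_k = 0` for all `k`; so `0 < Sβ.β0 k` fails. [cite: Balaban1987RG1, (2.12)–(2.14) p.268] -/
theorem oneLoopSplit_β0_record₈_of_zeroChart (θ : Stage8Params F N)
    (hρ : letI := θ.instVβ₁; letI := θ.instVβ₂; θ.ρ8 = 0)
    (S : B12Beta.OneLoopSplit (datumOfRecord₅ F N (θ.toStage5 F N)).βfun) (k : ℕ) : S.β0 k = 0 := by
  have h := S.split k (fun _ => 0)
  rw [S.vanish k _ rfl, add_zero] at h
  rw [← h, βfun_datumOfRecord₈_of_zeroChart F N θ hρ]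
  rfl

/-- … BY NAME: the one-loop numbers OF RECORD `beta0OfMerged βm₈ θ.v₀` (the `limUnder (𝓝[>] 0)` object of `Node00/BetaOfRecord.lean` at
the merged β of record) are the zero sequence at a zero-chart `θ` — N28's `β̄` in the currency of record is `0` there
(n23-b's `betaMerged_zeroChart` + `beta0OfMerged_zeroHBeta`). [cite: Balaban1987RG1, (1.22) p.264 and (2.12) p.268] -/
theorem beta0OfMerged_record₈_of_zeroChart (θ : Stage8Params F N)
    (hρ : letI := θ.instVβ₁; letI := θ.instVβ₂; θ.ρ8 = 0) :
    letI := θ.instVβ₁; letI := θ.instVβ₂; letI := θ.instιβ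
    beta0OfMerged (betaMerged F (mergedTermFamilyMat F N (chi7 F N θ) θ.εbg) θ.ρ8 θ.bV) θ.v₀ = fun _ => 0 := by
  letI := θ.instVβ₁; letI := θ.instVβ₂; letI := θ.instιβ
  rw [hρ, betaMerged_zeroChart, beta0OfMerged_zeroHBeta]

/-- **THE v0.29-SHAPED LEMMA IS NOT DISCHARGEABLE BY THE CHEAP INHABITANT**: a uniform asymptotic-freedom bound `BetaLowerH b γ' D.βfun`
with `0 < b` on a non-empty box `γ' > 0` — the DISPLAYED hypothesis `hlo` of `N28AtRecord8.beta0_record₈_pos_of_betaLowerH` (and (B3)'s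
AF lower half) — is FALSE at every zero-chart Stage-8 datum. [cite: Balaban1987RG1, Thm 2 (0.31) p.259] -/
theorem not_betaLowerH_record₈_of_zeroChart (θ : Stage8Params F N)
    (hρ : letI := θ.instVβ₁; letI := θ.instVβ₂; θ.ρ8 = 0) {b γ' : ℝ} (hb : 0 < b) (hγ' : 0 < γ') :
    ¬ BetaLowerH b γ' (datumOfRecord₅ F N (θ.toStage5 F N)).βfun := by
  rw [βfun_datumOfRecord₈_of_zeroChart F N θ hρ, betaLowerH_zeroHBeta_iff hγ']
  exact not_le.mpr hb

/-- **N28's `β̄`-half is junk-false at the zero chart — (β-AF) currency**: `BetaAFH D.βfun` fails. [cite: Balaban1987RG1, Thm 2 (0.31) p.259] -/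
theorem not_betaAFH_record₈_of_zeroChart (θ : Stage8Params F N)
    (hρ : letI := θ.instVβ₁; letI := θ.instVβ₂; θ.ρ8 = 0) :
    ¬ BetaAFH (datumOfRecord₅ F N (θ.toStage5 F N)).βfun := by
  rw [βfun_datumOfRecord₈_of_zeroChart F N θ hρ]
  exact not_betaAFH_zeroHBeta

/-- **N28's `β̄`-half is junk-false at the zero chart — LITERAL currency**: the packaged literal β-binder `BetaPertHyp D.βfun`
((B3) ∧ `0 < β̄` ∧ (B4) ∧ `0 < γc`) FAILS at every zero-chart Stage-8 datum; the violated conjunct is N28's `0 < β̄`.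
[cite: Balaban1989LargeFieldII, Thm 1 p.355] -/
theorem not_betaPertHyp_record₈_of_zeroChart (θ : Stage8Params F N)
    (hρ : letI := θ.instVβ₁; letI := θ.instVβ₂; θ.ρ8 = 0) :
    ¬ BetaPertHyp (datumOfRecord₅ F N (θ.toStage5 F N)).βfun := by
  rw [βfun_datumOfRecord₈_of_zeroChart F N θ hρ]
  exact not_betaPertHyp_zeroHBeta

/-- … while the literal package WITHOUT `0 < β̄` HOLDS at every zero-chart Stage-8 datum (`β̄ := 0`, `γc := 1`).
[cite: Balaban1989LargeFieldII, Thm 1 p.355] -/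
theorem betaPertHyp_dropSign_record₈_of_zeroChart (θ : Stage8Params F N)
    (hρ : letI := θ.instVβ₁; letI := θ.instVβ₂; θ.ρ8 = 0) :
    (∃ βbar : ℝ, BetaPertH (datumOfRecord₅ F N (θ.toStage5 F N)).βfun βbar) ∧
      ∃ γc : ℝ, 0 < γc ∧ BetaContH γc (datumOfRecord₅ F N (θ.toStage5 F N)).βfun := by
  rw [βfun_datumOfRecord₈_of_zeroChart F N θ hρ]
  exact betaPertHyp_dropSign_zeroHBeta

/-- **N28's `β̄ > 0` CERTIFIES A NON-ZERO CHART — (AF-0) currency**: if some one-loop number of some split of a Stage-8 datum's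
β-functions is positive, the realising parameter's chart is not the zero map (contrapositive of `oneLoopSplit_β0_record₈_of_zeroChart`).
So binder B6, read at the SAME witness (control rule v0.29), is itself a weak chart clause. [cite: Balaban1987RG1, (2.12)–(2.14) p.268] -/
theorem rho8_ne_zero_of_beta0_pos (θ : Stage8Params F N)
    (S : B12Beta.OneLoopSplit (datumOfRecord₅ F N (θ.toStage5 F N)).βfun) {k : ℕ} (hk : 0 < S.β0 k) :
    letI := θ.instVβ₁; letI := θ.instVβ₂; θ.ρ8 ≠ 0 :=
  fun hρ => hk.ne' (oneLoopSplit_β0_record₈_of_zeroChart θ hρ S k)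

/-- **… (β-AF) currency**: a uniform asymptotic-freedom bound `0 < b ≤ D.βfun` on a non-empty box certifies `θ.ρ8 ≠ 0`.
[cite: Balaban1987RG1, Thm 2 (0.31) p.259] -/
theorem rho8_ne_zero_of_betaLowerH (θ : Stage8Params F N) {b γ' : ℝ} (hb : 0 < b) (hγ' : 0 < γ')
    (hlo : BetaLowerH b γ' (datumOfRecord₅ F N (θ.toStage5 F N)).βfun) :
    letI := θ.instVβ₁; letI := θ.instVβ₂; θ.ρ8 ≠ 0 :=
  fun hρ => not_betaLowerH_record₈_of_zeroChart θ hρ hb hγ' hlo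

/-- **… LITERAL currency**: the packaged literal β-binder `BetaPertHyp D.βfun` (with N28's `0 < β̄`) certifies `θ.ρ8 ≠ 0`.
[cite: Balaban1989LargeFieldII, Thm 1 p.355] -/
theorem rho8_ne_zero_of_betaPertHyp (θ : Stage8Params F N) (hP : BetaPertHyp (datumOfRecord₅ F N (θ.toStage5 F N)).βfun) :
    letI := θ.instVβ₁; letI := θ.instVβ₂; θ.ρ8 ≠ 0 :=
  fun hρ => not_betaPertHyp_record₈_of_zeroChart θ hρ hP

/-! ## §3 Over the record predicate: N28's census at the cheap inhabitant -/

variable (F N) in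
/-- **N28 AT THE CHEAP INHABITANT OF `IsRecordOfRecord₈C` (ZEROCHART v0.33 for node N28, kernel form).**  For every four-torus family
and every `N ≥ 1` there is a Stage-8 record `(D, w)` (n23-b's zero-chart witness at `γ = 1` with its own world) at which:
N28's `γc`-half with (B4) HOLDS; the literal package minus `0 < β̄` HOLDS; every one-loop number of record is `0`; and `BetaAFH D.βfun`,
`BetaPertHyp D.βfun` FAIL.  So an `∃`-face over the record predicate reading (B4)∕the window∕`0 < γc` is junk-satisfiable, while NO
currency of N28's `0 < β̄` is satisfied by this inhabitant — `β̄ > 0` must be read from a witness displaying an AF bound (control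
rule v0.29), never from the predicate alone.  A probe of the TYPING; nothing of Bałaban's β asserted.
[cite: Balaban1987RG1, (1.20)–(1.22) p.264, (2.12)–(2.14) p.268; Balaban1989LargeFieldII, Thm 1 p.355] -/
theorem exists_isRecordOfRecord₈C_b6Census :
    ∃ (D : FiniteEpsData F (SU N)) (w : WorldP), IsRecordOfRecord₈C F N D w ∧
      (∃ γc : ℝ, 0 < γc ∧ BetaContH γc D.βfun) ∧
      ((∃ βbar : ℝ, BetaPertH D.βfun βbar) ∧ ∃ γc : ℝ, 0 < γc ∧ BetaContH γc D.βfun) ∧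
      (∀ S : B12Beta.OneLoopSplit D.βfun, ∀ k, S.β0 k = 0) ∧
      ¬ BetaAFH D.βfun ∧ ¬ BetaPertHyp D.βfun := by
  obtain ⟨θ, hθ, -, hγ, hρ⟩ := exists_admissible_stage8Params_zeroChart F N 1 one_pos
  obtain ⟨w, hw, -⟩ := exists_world_isRecordOfRecord₈C F N θ hθ (γw := 1) ⟨one_pos, by rw [hγ]⟩
  exact ⟨_, w, hw, b4_with_sideCondition_record₈_of_zeroChart θ hρ, betaPertHyp_dropSign_record₈_of_zeroChart θ hρ,
    fun S k => oneLoopSplit_β0_record₈_of_zeroChart θ hρ S k, not_betaAFH_record₈_of_zeroChart θ hρ,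
    not_betaPertHyp_record₈_of_zeroChart θ hρ⟩

/-! ## §4 The window form of the (B4)-with-`0 < γc` slot (dag-ref-D note N-n28-6) -/

/-- **(B4) WITH N28's SIDE CONDITION FROM THE WORLD's OWN BOX.**  For Stage-8 parameters `θ` and a world obeying the record's γ-clause
`0 < w.γ ≤ θ.γ`: joint continuity of the merged β of record on the binding world's box `]0, w.γ]^{k+1}` ALONE gives (B4) for the datum
with `γc := w.γ` (the datum's β agrees with `βm₈` on `Box θ.γ ⊇ Box w.γ`).  Sharper input than `N28AtRecord8.b4_with_sideCondition_record₈`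
(which asks it on the record box). [cite: Balaban1989LargeFieldII, Thm 1 p.355] -/
theorem b4_with_sideCondition_record₈_window (θ : Stage8Params F N) (w : WorldP) (hw : 0 < w.γ ∧ w.γ ≤ θ.γ)
    (hC : letI := θ.instVβ₁; letI := θ.instVβ₂; letI := θ.instιβ
      BetaContH w.γ (betaMerged F (mergedTermFamilyMat F N (chi7 F N θ) θ.εbg) θ.ρ8 θ.bV)) :
    0 < w.γ ∧ BetaContH w.γ (datumOfRecord₅ F N (θ.toStage5 F N)).βfun := by
  refine ⟨hw.1, ?_⟩
  rw [βfun_stage8]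
  exact betaContH_betaOfMerged_of_le le_rfl hw.2 hC

/-- … and conversely: (B4) for the datum on a window `w.γ ≤ θ.γ` GIVES the merged-β continuity on that window — the window slot is
realiser-independent (it reads `D.βfun` only; the one-box `iff` is dag-n26-a's `BalabanUVNodesN26AtRecord8.betaContH_datumOfRecord₈_iff`).
[cite: Balaban1987RG1, §1 p.264] -/
theorem betaContH_merged₈_of_b4_window (θ : Stage8Params F N) (w : WorldP) (hle : w.γ ≤ θ.γ)
    (hC : BetaContH w.γ (datumOfRecord₅ F N (θ.toStage5 F N)).βfun) :
    letI := θ.instVβ₁; letI := θ.instVβ₂; letI := θ.instιβ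
    BetaContH w.γ (betaMerged F (mergedTermFamilyMat F N (chi7 F N θ) θ.εbg) θ.ρ8 θ.bV) := by
  rw [βfun_stage8] at hC
  exact betaContH_merged_of_betaOfMerged le_rfl hle hC

/-- **(B4) WITH `0 < γc` AT A STAGE-8 RECORD, window form** (answers N-n28-6): if at every admissible Stage-8 parameter whose datum is
`D` and whose record box contains the world's window the merged β of record is jointly continuous on the WORLD's box `]0, w.γ]^{k+1}`,
then `(D, w)` satisfies (B4) with N28's side condition — witness `γc := w.γ`.  The slot is asked on `Box w.γ` only, not on the union
of the realisers' record boxes. [cite: Balaban1989LargeFieldII, Thm 1 p.355] -/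
theorem exists_b4_of_isRecordOfRecord₈C_window {D : FiniteEpsData F (SU N)} {w : WorldP} (h : IsRecordOfRecord₈C F N D w)
    (hC : ∀ θ : Stage8Params F N, θ.Admissible → D = datumOfRecord₅ F N (θ.toStage5 F N) → w.γ ≤ θ.γ →
      letI := θ.instVβ₁; letI := θ.instVβ₂; letI := θ.instιβ
      BetaContH w.γ (betaMerged F (mergedTermFamilyMat F N (chi7 F N θ) θ.εbg) θ.ρ8 θ.bV)) :
    ∃ γc : ℝ, 0 < γc ∧ BetaContH γc D.βfun := by
  obtain ⟨θ, hθ, hD, -, hw, -, -⟩ := h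
  subst hD
  exact ⟨w.γ, b4_with_sideCondition_record₈_window θ w hw (hC θ hθ rfl hw.2)⟩

end Summit.QuantumFields.YangMills.BalabanUVNodes.N28ZeroChart
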